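import Summits.MatrixMultiplication.OmegaCensus.DominoZ11Z11Cells
import Summits.MatrixMultiplication.OmegaCensus.DominoZ11Z11StructSixCells
import Summits.MatrixMultiplication.OmegaCensus.DominoZ11Z11StructSevenCells
import Summits.MatrixMultiplication.OmegaCensus.ThreeSetZ4Z4Cells
import Summits.MatrixMultiplication.OmegaCensus.DihedralLawModOneOrder25
import Summits.MatrixMultiplication.OmegaCensus.DihedralLawModOneZ11Z11OrdersArith
import HarnessLib

/-!
# The `|A| ≡ 1 (mod 3)` law over `A ↠ ℤ_11 × ℤ_11` with small element orders: `|A| = 484, 847`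

ω-census `pub-omega`, family (b3), seat pub-omega-group gen 38.  Framing: lottery ticket; floor = certified bounds/negative ranges.
VALUE: kernel theorems for the census lines `|A| = 484, 847` of the classification of dihedral-like groups attaining `3|S||T||U| + 8 = 8|A|`
('law ⟹ an element of order `≥ |A|/2`'), assembled from existing kernel domino cells over `ℤ_11²` and the structure theorems
(non-cube / two parts `1` / a part `2` ⇒ an element of order `≥ |A|/2`) — the `ℤ_11²` analogue of `DihedralLawModOneZ5Z5Orders.lean`;
no new computation; NOT progress on ω.  `no_mod_one_law_card_484/847_of_onto_z11z11`; instances in `DihedralLawModOneZ11Z11OrdersInstances.lean`.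
-/

namespace Summit.MatrixMultiplication.OmegaCensus

open Literature.Combinatorics.Additive Finset

section DihedralLike

variable {A : Type} [AddCommGroup A] [DecidableEq A] [Fintype A] {G : Type} [Group G] [DecidableEq G]
  {ρ τ : A → G} {c₀ : A} {S T U : Finset G}

/-- **No law over `A` of order `484` with all element orders `< |A|/2` and `A ↠ ℤ_11²`** (any presentation constant `c₀`):
cube shapes `stu = 161` — `(1,1,161)`, `(1,7,23)`: two parts `1`, or the cell `(1,7,23)` (`no_law_cube_17e_of_onto_z11z11`). [folklore] -/
theorem no_mod_one_law_card_484_of_onto_z11z11 (hA : Fintype.card A = 484) (hord : ∀ g : A, 2 * addOrderOf g < Fintype.card A)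
    (hρρ : ∀ a b, ρ a * ρ b = ρ (a + b)) (hρτ : ∀ a b, ρ a * τ b = τ (b - a))
    (hτρ : ∀ a b, τ a * ρ b = τ (a + b)) (hττ : ∀ a b, τ a * τ b = ρ (c₀ + b - a))
    (hρ : Function.Injective ρ) (hτ : Function.Injective τ) (hne : ∀ a b, ρ a ≠ τ b)
    (hsurj : ∀ g, (∃ a, ρ a = g) ∨ (∃ a, τ a = g))
    (Φ : A →+ ZMod 11 × ZMod 11) (hΦ : Function.Surjective Φ) (h : TripleProductProperty S T U) :
    3 * (S.card * T.card * U.card) + 8 ≠ 8 * Fintype.card A := by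
  intro hV
  have big : ¬ ∃ g : A, Fintype.card A ≤ 2 * addOrderOf g := by
    rintro ⟨g, hg⟩; exact absurd (hord g) (not_lt.2 hg)
  have hmod : Fintype.card A % 3 = 1 := by rw [hA]
  have hA14 : 14 ≤ Fintype.card A := by rw [hA]; norm_num
  have hA7 : 7 ≤ Fintype.card A := by omega
  have hV_TUS : 3 * (T.card * U.card * S.card) + 8 = 8 * Fintype.card A := by
    rw [show T.card * U.card * S.card = S.card * T.card * U.card by ring]; exact hV
  have hV_UST : 3 * (U.card * S.card * T.card) + 8 = 8 * Fintype.card A := by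
    rw [show U.card * S.card * T.card = S.card * T.card * U.card by ring]; exact hV
  have hTUS : TripleProductProperty T U S := h.rotate
  have hUST : TripleProductProperty U S T := h.rotate.rotate
  by_cases hnc : ((univ.filter fun a : A => ρ a ∈ S).card = (univ.filter fun a : A => τ a ∈ S).card ∧
      (univ.filter fun a : A => ρ a ∈ T).card = (univ.filter fun a : A => τ a ∈ T).card ∧
      (univ.filter fun a : A => ρ a ∈ U).card = (univ.filter fun a : A => τ a ∈ U).card)
  · obtain ⟨hS', hT', hU'⟩ := hnc
    have cS := card_eq_parts' hρ hτ hne hsurj S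
    have cT := card_eq_parts' hρ hτ hne hsurj T
    have cU := card_eq_parts' hρ hτ hne hsurj U
    set s₀ := (univ.filter fun a : A => ρ a ∈ S).card with hs₀
    set t₀ := (univ.filter fun a : A => ρ a ∈ T).card with ht₀
    set u₀ := (univ.filter fun a : A => ρ a ∈ U).card with hu₀
    have eS : S.card = 2 * s₀ := by rw [cS, ← hS']; ring
    have eT : T.card = 2 * t₀ := by rw [cT, ← hT']; ring
    have eU : U.card = 2 * u₀ := by rw [cU, ← hU']; ring
    have hprod : 3 * (s₀ * t₀ * u₀) + 1 = 484 := by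
      rw [eS, eT, eU, hA] at hV; nlinarith
    rcases cube_factor_of_484 hprod with ⟨h1, h2, h3⟩ | ⟨h1, h2, h3⟩ | ⟨h1, h2, h3⟩ | ⟨h1, h2, h3⟩ | ⟨h1, h2, h3⟩ | ⟨h1, h2, h3⟩ | ⟨h1, h2, h3⟩ | ⟨h1, h2, h3⟩ | ⟨h1, h2, h3⟩
    · -- (1,1,161)
      exact big (card_le_two_mul_addOrderOf_of_two_two_law hρρ hρτ hτρ hττ hρ hτ hne hsurj hmod hA7 h (by rw [eS, h1]) (by rw [eT, h2]) hV)
    · -- (1,7,23)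
      exact absurd hV (no_law_cube_two_parts_of_ordered 1 7 (fun h' hS₀ hS₁ hT₀ hT₁ hU'' hV'' => no_law_cube_17e_of_onto_z11z11 hρρ hρτ hτρ hττ hρ hτ hne hsurj Φ hΦ h' hS₀ hS₁ hT₀ hT₁ hU'' hV'') h hS' hT' hU'
        (Or.inl ⟨h1, h2⟩))
    · -- (1,23,7)
      exact absurd hV (no_law_cube_two_parts_of_ordered 1 7 (fun h' hS₀ hS₁ hT₀ hT₁ hU'' hV'' => no_law_cube_17e_of_onto_z11z11 hρρ hρτ hτρ hττ hρ hτ hne hsurj Φ hΦ h' hS₀ hS₁ hT₀ hT₁ hU'' hV'') h hS' hT' hU'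
        (Or.inr (Or.inr (Or.inr (Or.inr (Or.inr (⟨h3, h1⟩)))))))
    · -- (1,161,1)
      exact big (card_le_two_mul_addOrderOf_of_two_two_law hρρ hρτ hτρ hττ hρ hτ hne hsurj hmod hA7 hUST (by rw [eU, h3]) (by rw [eS, h1]) hV_UST)
    · -- (7,1,23)
      exact absurd hV (no_law_cube_two_parts_of_ordered 1 7 (fun h' hS₀ hS₁ hT₀ hT₁ hU'' hV'' => no_law_cube_17e_of_onto_z11z11 hρρ hρτ hτρ hττ hρ hτ hne hsurj Φ hΦ h' hS₀ hS₁ hT₀ hT₁ hU'' hV'') h hS' hT' hU'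
        (Or.inr (Or.inr (Or.inr (Or.inl ⟨h1, h2⟩)))))
    · -- (7,23,1)
      exact absurd hV (no_law_cube_two_parts_of_ordered 1 7 (fun h' hS₀ hS₁ hT₀ hT₁ hU'' hV'' => no_law_cube_17e_of_onto_z11z11 hρρ hρτ hτρ hττ hρ hτ hne hsurj Φ hΦ h' hS₀ hS₁ hT₀ hT₁ hU'' hV'') h hS' hT' hU'
        (Or.inr (Or.inr (Or.inl ⟨h3, h1⟩))))
    · -- (23,1,7)
      exact absurd hV (no_law_cube_two_parts_of_ordered 1 7 (fun h' hS₀ hS₁ hT₀ hT₁ hU'' hV'' => no_law_cube_17e_of_onto_z11z11 hρρ hρτ hτρ hττ hρ hτ hne hsurj Φ hΦ h' hS₀ hS₁ hT₀ hT₁ hU'' hV'') h hS' hT' hU'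
        (Or.inr (Or.inl ⟨h2, h3⟩)))
    · -- (23,7,1)
      exact absurd hV (no_law_cube_two_parts_of_ordered 1 7 (fun h' hS₀ hS₁ hT₀ hT₁ hU'' hV'' => no_law_cube_17e_of_onto_z11z11 hρρ hρτ hτρ hττ hρ hτ hne hsurj Φ hΦ h' hS₀ hS₁ hT₀ hT₁ hU'' hV'') h hS' hT' hU'
        (Or.inr (Or.inr (Or.inr (Or.inr (Or.inl ⟨h2, h3⟩))))))
    · -- (161,1,1)
      exact big (card_le_two_mul_addOrderOf_of_two_two_law hρρ hρτ hτρ hττ hρ hτ hne hsurj hmod hA7 hTUS (by rw [eT, h2]) (by rw [eU, h3]) hV_TUS)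
  · obtain ⟨g, a, b, hab⟩ :=
      two_cosets_of_mod_one_law_of_not_cube hρρ hρτ hτρ hττ hρ hτ hne hsurj hmod hA14 h hV hnc
    exact big ⟨g, card_le_two_mul_addOrderOf_of_two_cosets hab⟩

/-- **No law over `A` of order `847` with all element orders `< |A|/2` and `A ↠ ℤ_11²`** (any presentation constant `c₀`):
cube shapes `stu = 282` — `(1,1,282)`, `(1,2,141)`, `(1,3,94)`, `(1,6,47)`, `(2,3,47)`: two parts `1`, a part `2`, or the cells `(1,3,94)`, `(1,6,47)` (`no_law_cube_13e/16e_of_onto_z11z11`). [folklore] -/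
theorem no_mod_one_law_card_847_of_onto_z11z11 (hA : Fintype.card A = 847) (hord : ∀ g : A, 2 * addOrderOf g < Fintype.card A)
    (hρρ : ∀ a b, ρ a * ρ b = ρ (a + b)) (hρτ : ∀ a b, ρ a * τ b = τ (b - a))
    (hτρ : ∀ a b, τ a * ρ b = τ (a + b)) (hττ : ∀ a b, τ a * τ b = ρ (c₀ + b - a))
    (hρ : Function.Injective ρ) (hτ : Function.Injective τ) (hne : ∀ a b, ρ a ≠ τ b)
    (hsurj : ∀ g, (∃ a, ρ a = g) ∨ (∃ a, τ a = g))
    (Φ : A →+ ZMod 11 × ZMod 11) (hΦ : Function.Surjective Φ) (h : TripleProductProperty S T U) :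
    3 * (S.card * T.card * U.card) + 8 ≠ 8 * Fintype.card A := by
  intro hV
  have big : ¬ ∃ g : A, Fintype.card A ≤ 2 * addOrderOf g := by
    rintro ⟨g, hg⟩; exact absurd (hord g) (not_lt.2 hg)
  have hmod : Fintype.card A % 3 = 1 := by rw [hA]
  have hA14 : 14 ≤ Fintype.card A := by rw [hA]; norm_num
  have hA7 : 7 ≤ Fintype.card A := by omega
  have hV_TUS : 3 * (T.card * U.card * S.card) + 8 = 8 * Fintype.card A := by
    rw [show T.card * U.card * S.card = S.card * T.card * U.card by ring]; exact hV
  have hV_UST : 3 * (U.card * S.card * T.card) + 8 = 8 * Fintype.card A := by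
    rw [show U.card * S.card * T.card = S.card * T.card * U.card by ring]; exact hV
  have hTUS : TripleProductProperty T U S := h.rotate
  have hUST : TripleProductProperty U S T := h.rotate.rotate
  by_cases hnc : ((univ.filter fun a : A => ρ a ∈ S).card = (univ.filter fun a : A => τ a ∈ S).card ∧
      (univ.filter fun a : A => ρ a ∈ T).card = (univ.filter fun a : A => τ a ∈ T).card ∧
      (univ.filter fun a : A => ρ a ∈ U).card = (univ.filter fun a : A => τ a ∈ U).card)
  · obtain ⟨hS', hT', hU'⟩ := hnc
    have cS := card_eq_parts' hρ hτ hne hsurj S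
    have cT := card_eq_parts' hρ hτ hne hsurj T
    have cU := card_eq_parts' hρ hτ hne hsurj U
    set s₀ := (univ.filter fun a : A => ρ a ∈ S).card with hs₀
    set t₀ := (univ.filter fun a : A => ρ a ∈ T).card with ht₀
    set u₀ := (univ.filter fun a : A => ρ a ∈ U).card with hu₀
    have eS : S.card = 2 * s₀ := by rw [cS, ← hS']; ring
    have eT : T.card = 2 * t₀ := by rw [cT, ← hT']; ring
    have eU : U.card = 2 * u₀ := by rw [cU, ← hU']; ring
    have hprod : 3 * (s₀ * t₀ * u₀) + 1 = 847 := by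
      rw [eS, eT, eU, hA] at hV; nlinarith
    rcases cube_factor_of_847 hprod with ⟨h1, h2, h3⟩ | ⟨h1, h2, h3⟩ | ⟨h1, h2, h3⟩ | ⟨h1, h2, h3⟩ | ⟨h1, h2, h3⟩ | ⟨h1, h2, h3⟩ | ⟨h1, h2, h3⟩ | ⟨h1, h2, h3⟩ | ⟨h1, h2, h3⟩ | ⟨h1, h2, h3⟩ | ⟨h1, h2, h3⟩ | ⟨h1, h2, h3⟩ | ⟨h1, h2, h3⟩ | ⟨h1, h2, h3⟩ | ⟨h1, h2, h3⟩ | ⟨h1, h2, h3⟩ | ⟨h1, h2, h3⟩ | ⟨h1, h2, h3⟩ | ⟨h1, h2, h3⟩ | ⟨h1, h2, h3⟩ | ⟨h1, h2, h3⟩ | ⟨h1, h2, h3⟩ | ⟨h1, h2, h3⟩ | ⟨h1, h2, h3⟩ | ⟨h1, h2, h3⟩ | ⟨h1, h2, h3⟩ | ⟨h1, h2, h3⟩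
    · -- (1,1,282)
      exact big (card_le_two_mul_addOrderOf_of_two_two_law hρρ hρτ hτρ hττ hρ hτ hne hsurj hmod hA7 h (by rw [eS, h1]) (by rw [eT, h2]) hV)
    · -- (1,2,141)
      exact big (card_le_two_mul_addOrderOf_of_mod_one_law_card_four hρρ hρτ hτρ hττ hρ hτ hne hsurj hmod hA14 h hV (by rw [eT, h2]))
    · -- (1,3,94)
      exact absurd hV (no_law_cube_two_parts_of_ordered 1 3 (fun h' hS₀ hS₁ hT₀ hT₁ hU'' hV'' => no_law_cube_13e_of_onto_z11z11 hρρ hρτ hτρ hττ hρ hτ hne hsurj Φ hΦ h' hS₀ hS₁ hT₀ hT₁ hU'' hV'') h hS' hT' hU'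
        (Or.inl ⟨h1, h2⟩))
    · -- (1,6,47)
      exact absurd hV (no_law_cube_two_parts_of_ordered 1 6 (fun h' hS₀ hS₁ hT₀ hT₁ hU'' hV'' => no_law_cube_16e_of_onto_z11z11 hρρ hρτ hτρ hττ hρ hτ hne hsurj Φ hΦ h' hS₀ hS₁ hT₀ hT₁ hU'' hV'') h hS' hT' hU'
        (Or.inl ⟨h1, h2⟩))
    · -- (1,47,6)
      exact absurd hV (no_law_cube_two_parts_of_ordered 1 6 (fun h' hS₀ hS₁ hT₀ hT₁ hU'' hV'' => no_law_cube_16e_of_onto_z11z11 hρρ hρτ hτρ hττ hρ hτ hne hsurj Φ hΦ h' hS₀ hS₁ hT₀ hT₁ hU'' hV'') h hS' hT' hU'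
        (Or.inr (Or.inr (Or.inr (Or.inr (Or.inr (⟨h3, h1⟩)))))))
    · -- (1,94,3)
      exact absurd hV (no_law_cube_two_parts_of_ordered 1 3 (fun h' hS₀ hS₁ hT₀ hT₁ hU'' hV'' => no_law_cube_13e_of_onto_z11z11 hρρ hρτ hτρ hττ hρ hτ hne hsurj Φ hΦ h' hS₀ hS₁ hT₀ hT₁ hU'' hV'') h hS' hT' hU'
        (Or.inr (Or.inr (Or.inr (Or.inr (Or.inr (⟨h3, h1⟩)))))))
    · -- (1,141,2)
      exact big (card_le_two_mul_addOrderOf_of_mod_one_law_card_four hρρ hρτ hτρ hττ hρ hτ hne hsurj hmod hA14 hTUS hV_TUS (by rw [eU, h3]))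
    · -- (1,282,1)
      exact big (card_le_two_mul_addOrderOf_of_two_two_law hρρ hρτ hτρ hττ hρ hτ hne hsurj hmod hA7 hUST (by rw [eU, h3]) (by rw [eS, h1]) hV_UST)
    · -- (2,1,141)
      exact big (card_le_two_mul_addOrderOf_of_mod_one_law_card_four hρρ hρτ hτρ hττ hρ hτ hne hsurj hmod hA14 hUST hV_UST (by rw [eS, h1]))
    · -- (2,3,47)
      exact big (card_le_two_mul_addOrderOf_of_mod_one_law_card_four hρρ hρτ hτρ hττ hρ hτ hne hsurj hmod hA14 hUST hV_UST (by rw [eS, h1]))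
    · -- (2,47,3)
      exact big (card_le_two_mul_addOrderOf_of_mod_one_law_card_four hρρ hρτ hτρ hττ hρ hτ hne hsurj hmod hA14 hUST hV_UST (by rw [eS, h1]))
    · -- (2,141,1)
      exact big (card_le_two_mul_addOrderOf_of_mod_one_law_card_four hρρ hρτ hτρ hττ hρ hτ hne hsurj hmod hA14 hUST hV_UST (by rw [eS, h1]))
    · -- (3,1,94)
      exact absurd hV (no_law_cube_two_parts_of_ordered 1 3 (fun h' hS₀ hS₁ hT₀ hT₁ hU'' hV'' => no_law_cube_13e_of_onto_z11z11 hρρ hρτ hτρ hττ hρ hτ hne hsurj Φ hΦ h' hS₀ hS₁ hT₀ hT₁ hU'' hV'') h hS' hT' hU'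
        (Or.inr (Or.inr (Or.inr (Or.inl ⟨h1, h2⟩)))))
    · -- (3,2,47)
      exact big (card_le_two_mul_addOrderOf_of_mod_one_law_card_four hρρ hρτ hτρ hττ hρ hτ hne hsurj hmod hA14 h hV (by rw [eT, h2]))
    · -- (3,47,2)
      exact big (card_le_two_mul_addOrderOf_of_mod_one_law_card_four hρρ hρτ hτρ hττ hρ hτ hne hsurj hmod hA14 hTUS hV_TUS (by rw [eU, h3]))
    · -- (3,94,1)
      exact absurd hV (no_law_cube_two_parts_of_ordered 1 3 (fun h' hS₀ hS₁ hT₀ hT₁ hU'' hV'' => no_law_cube_13e_of_onto_z11z11 hρρ hρτ hτρ hττ hρ hτ hne hsurj Φ hΦ h' hS₀ hS₁ hT₀ hT₁ hU'' hV'') h hS' hT' hU'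
        (Or.inr (Or.inr (Or.inl ⟨h3, h1⟩))))
    · -- (6,1,47)
      exact absurd hV (no_law_cube_two_parts_of_ordered 1 6 (fun h' hS₀ hS₁ hT₀ hT₁ hU'' hV'' => no_law_cube_16e_of_onto_z11z11 hρρ hρτ hτρ hττ hρ hτ hne hsurj Φ hΦ h' hS₀ hS₁ hT₀ hT₁ hU'' hV'') h hS' hT' hU'
        (Or.inr (Or.inr (Or.inr (Or.inl ⟨h1, h2⟩)))))
    · -- (6,47,1)
      exact absurd hV (no_law_cube_two_parts_of_ordered 1 6 (fun h' hS₀ hS₁ hT₀ hT₁ hU'' hV'' => no_law_cube_16e_of_onto_z11z11 hρρ hρτ hτρ hττ hρ hτ hne hsurj Φ hΦ h' hS₀ hS₁ hT₀ hT₁ hU'' hV'') h hS' hT' hU'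
        (Or.inr (Or.inr (Or.inl ⟨h3, h1⟩))))
    · -- (47,1,6)
      exact absurd hV (no_law_cube_two_parts_of_ordered 1 6 (fun h' hS₀ hS₁ hT₀ hT₁ hU'' hV'' => no_law_cube_16e_of_onto_z11z11 hρρ hρτ hτρ hττ hρ hτ hne hsurj Φ hΦ h' hS₀ hS₁ hT₀ hT₁ hU'' hV'') h hS' hT' hU'
        (Or.inr (Or.inl ⟨h2, h3⟩)))
    · -- (47,2,3)
      exact big (card_le_two_mul_addOrderOf_of_mod_one_law_card_four hρρ hρτ hτρ hττ hρ hτ hne hsurj hmod hA14 h hV (by rw [eT, h2]))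
    · -- (47,3,2)
      exact big (card_le_two_mul_addOrderOf_of_mod_one_law_card_four hρρ hρτ hτρ hττ hρ hτ hne hsurj hmod hA14 hTUS hV_TUS (by rw [eU, h3]))
    · -- (47,6,1)
      exact absurd hV (no_law_cube_two_parts_of_ordered 1 6 (fun h' hS₀ hS₁ hT₀ hT₁ hU'' hV'' => no_law_cube_16e_of_onto_z11z11 hρρ hρτ hτρ hττ hρ hτ hne hsurj Φ hΦ h' hS₀ hS₁ hT₀ hT₁ hU'' hV'') h hS' hT' hU'
        (Or.inr (Or.inr (Or.inr (Or.inr (Or.inl ⟨h2, h3⟩))))))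
    · -- (94,1,3)
      exact absurd hV (no_law_cube_two_parts_of_ordered 1 3 (fun h' hS₀ hS₁ hT₀ hT₁ hU'' hV'' => no_law_cube_13e_of_onto_z11z11 hρρ hρτ hτρ hττ hρ hτ hne hsurj Φ hΦ h' hS₀ hS₁ hT₀ hT₁ hU'' hV'') h hS' hT' hU'
        (Or.inr (Or.inl ⟨h2, h3⟩)))
    · -- (94,3,1)
      exact absurd hV (no_law_cube_two_parts_of_ordered 1 3 (fun h' hS₀ hS₁ hT₀ hT₁ hU'' hV'' => no_law_cube_13e_of_onto_z11z11 hρρ hρτ hτρ hττ hρ hτ hne hsurj Φ hΦ h' hS₀ hS₁ hT₀ hT₁ hU'' hV'') h hS' hT' hU'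
        (Or.inr (Or.inr (Or.inr (Or.inr (Or.inl ⟨h2, h3⟩))))))
    · -- (141,1,2)
      exact big (card_le_two_mul_addOrderOf_of_mod_one_law_card_four hρρ hρτ hτρ hττ hρ hτ hne hsurj hmod hA14 hTUS hV_TUS (by rw [eU, h3]))
    · -- (141,2,1)
      exact big (card_le_two_mul_addOrderOf_of_mod_one_law_card_four hρρ hρτ hτρ hττ hρ hτ hne hsurj hmod hA14 h hV (by rw [eT, h2]))
    · -- (282,1,1)
      exact big (card_le_two_mul_addOrderOf_of_two_two_law hρρ hρτ hτρ hττ hρ hτ hne hsurj hmod hA7 hTUS (by rw [eT, h2]) (by rw [eU, h3]) hV_TUS)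
  · obtain ⟨g, a, b, hab⟩ :=
      two_cosets_of_mod_one_law_of_not_cube hρρ hρτ hτρ hττ hρ hτ hne hsurj hmod hA14 h hV hnc
    exact big ⟨g, card_le_two_mul_addOrderOf_of_two_cosets hab⟩

end DihedralLike

end Summit.MatrixMultiplication.OmegaCensus
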